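import Summits.PneNP.PneNP.Theorems.SymmetryBudgetNoHiddenOrderPerPathCGAdm

/-!
# The generic replay decoding on the Corneil–Goldberg process: right on the solution subtree; completeness with `AdmB` for any valuation

Route `PneNP/SymmetryBudget`, `NoHiddenOrder` (stmt-PneNP-14781); (R2c) support. The (R2c) value layer of seat -1 realises the GENERIC decoding
`CertifiedLabels.replay (cgProcess G) L I₀ ∅` as a fixed-depth walk (`…DecodeWalk.lean`) and uses its own bit valuation (`…BitValuation*.lean`).
For that configuration this file packages, once, what the function level owes it:

* `cg_replay_reach` — the generic replay is RIGHT ON THE SOLUTION SUBTREE of the concrete process (selector `cgSel`, values the heights):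
  `CertifiedLabels.replay (cgProcess G) ⟨I.1.1, X, λ⟩ I₀ ∅ = some I` for every reached `(I, X, λ)` (`replay_correct` with its six hypotheses
  discharged: `cgSel_mem`, `cgSel_fresh`, `cgStep_parts_disjoint`, `verts_nonempty`, `verts_cgChild`, (C1′) `hgt_lt_of_reachFrom`);
* `cg_root_good_replay_admB` — **for ANY valuation, with the generic replay decoding, admissibility `AdmB (4|V| + ⌊log₂|V|⌋)` and value range
  `|V|`, the root group outputs a good value** (equitable start); `cg_root_good_replay_admB_refineIn` from `(W, refineIn G W λ₀)`;
* `cg_root_value_replay_admB` — the same for the realised valuation `cgValuation` (a copy of the start block).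
-/

-- `Summit.PneNP.PneNP.…` duplicates `PneNP` BY DESIGN (single-problem summit, D-0017 layout).
set_option linter.dupNamespace false

namespace Summit.PneNP.PneNP.Theorems

open Finset

namespace BranchSum

variable {V : Type*} [Fintype V] [DecidableEq V] {G : SimpleGraph V} [DecidableRel G.Adj] {I₀ : CGInst V}

/-- **The generic replay is right on the solution subtree** of the concrete process (selector `cgSel`, values the heights). -/
theorem cg_replay_reach {I : (cgProcess G).Inst} {X : Finset V} {lam : V → ℕ}
    (h : CertifiedLabels.Reach (cgProcess G) (cgSel (V := V)) (hgt G cgSel) I₀ I X lam) :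
    CertifiedLabels.replay (cgProcess G) ⟨I.1.1, X, lam⟩ I₀ ∅ = some I := by
  refine CertifiedLabels.replay_correct (P := cgProcess G) (sel := cgSel (V := V)) (hv := hgt G cgSel) (I₀ := I₀) cgSel_mem
    (fun I X lam A ch hR hs => cgSel_fresh cgSel_mem I X lam A ch hR hs) cgStep_parts_disjoint verts_nonempty (fun I A ch hs => ?_)
    (fun I X lam A ch _ hs β Xβ lamβ Aβ chβ hR _ hβA => hgt_lt_of_reachFrom cgSel_mem I A ch hs hR hβA)
    (CertifiedLabels.reachFrom_root_of_reach h) CertifiedLabels.Reach.root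
  obtain ⟨-, -, -, rfl⟩ := cgStep_eq_orNode_iff.1 hs
  rfl

/-- **Completeness for any valuation with the generic replay decoding and admissibility `AdmB`**: the root group outputs a good value
(value range `|V|`, equitable start). -/
theorem cg_root_good_replay_admB {Val : Type*} [DecidableEq Val] (Vl : CertifiedLabels.Valuation (cgProcess G) Val)
    (hI₀ : ∀ u ∈ I₀.1.1, ∀ u' ∈ I₀.1.1, I₀.1.2 u = I₀.1.2 u' → ∀ w ∈ I₀.1.1,
      ((cellOf I₀.1.1 I₀.1.2 w).filter fun y => G.Adj u y).card = ((cellOf I₀.1.1 I₀.1.2 w).filter fun y => G.Adj u' y).card) :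
    ∃ v : Val, CertifiedLabels.val (cgProcess G) Vl (fun L => CertifiedLabels.replay (cgProcess G) L I₀ ∅)
      (fun L => AdmB (4 * Fintype.card V + Nat.log 2 (Fintype.card V)) L.X L.lam) (Fintype.card V) ⟨I₀.1.1, ∅, fun _ => 0⟩ = some v ∧
      Vl.Good I₀ v :=
  cg_root_good_dec_admB Vl hI₀ _ fun _ _ _ h => cg_replay_reach h

/-- The same from a block `W` with the refinement of a start colouring `λ₀` (window: `V` the window type, `W = univ`, `λ₀` the signature ranks). -/
theorem cg_root_good_replay_admB_refineIn {Val : Type*} [DecidableEq Val] (Vl : CertifiedLabels.Valuation (cgProcess G) Val)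
    {W : Finset V} (hW : W.Nonempty) (lam₀ : V → ℕ) :
    ∃ v : Val, CertifiedLabels.val (cgProcess G) Vl (fun L => CertifiedLabels.replay (cgProcess G) L ⟨(W, refineIn G W lam₀), hW⟩ ∅)
      (fun L => AdmB (4 * Fintype.card V + Nat.log 2 (Fintype.card V)) L.X L.lam) (Fintype.card V) ⟨W, ∅, fun _ => 0⟩ = some v ∧
      Vl.Good ⟨(W, refineIn G W lam₀), hW⟩ v :=
  cg_root_good_replay_admB (I₀ := ⟨(W, refineIn G W lam₀), hW⟩) Vl
    (fun _ hu _ hu' huu' _ hw => equitableIn_refineIn W lam₀ hu hu' huu' hw)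

/-- **The realised scheme with the generic replay decoding and admissibility `AdmB` outputs a copy of the start block at the root.** -/
theorem cg_root_value_replay_admB
    (hI₀ : ∀ u ∈ I₀.1.1, ∀ u' ∈ I₀.1.1, I₀.1.2 u = I₀.1.2 u' → ∀ w ∈ I₀.1.1,
      ((cellOf I₀.1.1 I₀.1.2 w).filter fun y => G.Adj u y).card = ((cellOf I₀.1.1 I₀.1.2 w).filter fun y => G.Adj u' y).card) :
    ∃ E : Enc, CertifiedLabels.val (cgProcess G) (cgValuation G) (fun L => CertifiedLabels.replay (cgProcess G) L I₀ ∅)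
        (fun L => AdmB (4 * Fintype.card V + Nat.log 2 (Fintype.card V)) L.X L.lam) (Fintype.card V) ⟨I₀.1.1, ∅, fun _ => 0⟩ = some E ∧
      ∃ l : List V, l.Nodup ∧ l.toFinset = I₀.1.1 ∧ E = encOf G I₀.1.2 l :=
  cg_root_good_replay_admB (cgValuation G) hI₀

/-- Along the solution subtree the values are admissible AND every group is valued — for any valuation and the generic replay decoding
(the shape `val_complete` delivers, recorded for the compiler's per-group semantics). -/
theorem cg_val_ne_none_of_reach_replay_admB {Val : Type*} [DecidableEq Val] (Vl : CertifiedLabels.Valuation (cgProcess G) Val)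
    (hI₀ : ∀ u ∈ I₀.1.1, ∀ u' ∈ I₀.1.1, I₀.1.2 u = I₀.1.2 u' → ∀ w ∈ I₀.1.1,
      ((cellOf I₀.1.1 I₀.1.2 w).filter fun y => G.Adj u y).card = ((cellOf I₀.1.1 I₀.1.2 w).filter fun y => G.Adj u' y).card)
    {I : (cgProcess G).Inst} {X : Finset V} {lam : V → ℕ}
    (h : CertifiedLabels.Reach (cgProcess G) (cgSel (V := V)) (hgt G cgSel) I₀ I X lam) :
    CertifiedLabels.val (cgProcess G) Vl (fun L => CertifiedLabels.replay (cgProcess G) L I₀ ∅)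
      (fun L => AdmB (4 * Fintype.card V + Nat.log 2 (Fintype.card V)) L.X L.lam) (Fintype.card V) ⟨I.1.1, X, lam⟩ ≠ none :=
  cg_val_ne_none_of_reach_dec Vl _ (fun _ _ _ h => cg_replay_reach h) _ (fun _ _ _ h => admB_of_reach hI₀ h) _ X lam h

end BranchSum

end Summit.PneNP.PneNP.Theorems
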